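import Mathlib.Tactic.LinearCombination
import Mathlib.Tactic.Zify
import Summits.PneNP.GCT.Max.KYAllMArithmetic

/-!
# KYKOneExact — the exact `k = 1` leading-term count and a kernel-checkable cell test (toolkit for W1′b, the
# `n ≥ ⌈3m/2⌉` Koszul–Young ceiling)

Cell `pub-gct-max` (HOME `run/shared/lean/pub/pub-gct-max/`), track F, THEORY-2 gen 27.  The all-`m` ceilings
`KYCannotSeparatePaddedPerAllM` (`n ≥ 2m+2`) and `KYCannotSeparatePaddedPerSharper` (`m ≥ 5`, `2n ≥ 3m+2`) bound the
leading-term count `LT = DetKYLeadingTerms.ltCount` from below by the CLOSED FORMS `CHEB`, `TK`.  One step lower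
(`n = ⌈3m/2⌉`) those closed forms miss a thin window of cells (`k = 1`, `9 ≤ c ≤ c₁(m)` with `c₁(m) ≤ 58` and
`c₁(m) = 9` for even `m ≥ 48`, none for odd `m ≥ 35`, when `13 ≤ m ≤ 63`; wider `k = 1` boxes and one `k = 2` window
(`m = 6`) when `m ≤ 12`; 1 180 cells in all — exact numerics `pub-gct-max-theory-2/FINDINGS-W1B-K1IDENT.md`), although
the exact `LT` certifies every one of them.  This module supplies the exact `k = 1` count in closed two-sum form and a kernel mirror, so
that such cells are decided by `decide +kernel` in a fraction of a second each:

* `inner_identity`      : `Σ_{j<L} j·C(a+j,c) + (a+1)·C(a+L,c+1) + (c+1)·C(a+1,c+2) = (c+1)·C(a+L+1,c+2) + (a+1)·C(a,c+1)`;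
* `row_identity`        : `(c+2)·Σ_{j<n} j·C(a+j,c) + (a+1)·C(a+n,c+1) = (c+1)·n·C(a+n,c+1) + (a+1)·C(a,c+1)`;
* `ltCount_one_identity`: `(c+2)·LT(n,c,1) + (n-1)(n²+1)·C(n²,c+1) + n(c+2)·Σ_{i<n} C(i·n,c+1)
                             = (n-1)(c+2)·n·C(n²,c+1) + (c+3)·n·Σ_{i<n} i·C(i·n,c+1) + Σ_{i<n} C(i·n,c+1)`,
  i.e. over `ℚ`: `LT(n,c,1) = (n-1)((c+2)n-n²-1)/(c+2)·C(n²,c+1) + Σ_{i<n} [(c+3)n·i - (c+2)n + 1]/(c+2)·C(i·n,c+1)`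
  (Abel summation of the row identity; the first summand is negative for `c ≤ n-2`, the bracket positive for `i ≥ 1`);
* `ltOneD n c` — a kernel mirror of `LT(n,c,1)` with `2n+1` binomials (`descFactorial / factorial`, GMP in the kernel)
  and `ltOneD_eq : ltOneD n c = ltCount n c 1`;
* `kOneCell m n c` (`Bool`) with `kOneCell_sound : kOneCell m n c = true →
     min (S(m,1)·C(n²,c+1)) (S(m,2)·C(n²,c)) ≤ LT(n,c,1)` — the primal `k = 1` cell inequality of the W1′ assemblies;
* `kCell m n c k` (`Bool`, brute-force mirror `ltCountD`, `n²` terms) with `kCell_sound`, for the few `k ≥ 2` cells;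
* ALL 1 180 residual cells of the `n = ⌈3m/2⌉` programme (the cells at `n = ⌈3m/2⌉`, `5 ≤ m ≤ 63`, that the closed forms
  `max(CHEB,TK)` of `Max/KYSharperLowK` do not certify) as kernel-decided theorems: `window_5_12` (`k = 1`, `8 ≤ c < n²`),
  `window_6_k2` (`m = 6`, `k = 2`, `21 ≤ c ≤ 80`), `window_13_63` (`k = 1`, `9 ≤ c ≤ cBox m`, three boxes) — 2 010 decided
  cells, `decide +kernel`, a few seconds in all.

Everything is PROVED (Mathlib + `Max/KYAllMArithmetic` only).  HONEST FRAMING: binomial-sum identities and finitely many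
numerical inequalities between binomial expressions — bookkeeping for a ceiling theorem about ONE technique class (plain
Koszul–Young flattenings of padded permanents); not a statement about orbit closures, `per` versus `det`, VP versus VNP or
P versus NP; it moves no census row. [folklore]
-/

namespace Summit.PneNP.GCT
namespace KYKOneExact

open Finset DetKYLeadingTerms KYAllM

/-! ## The `k = 1` identities -/

/-- Inner hockey stick with a linear weight:
`Σ_{j<L} j·C(a+j,c) + (a+1)·C(a+L,c+1) + (c+1)·C(a+1,c+2) = (c+1)·C(a+L+1,c+2) + (a+1)·C(a,c+1)`. [folklore] -/
theorem inner_identity (a c L : ℕ) :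
    (∑ j ∈ range L, j * (a + j).choose c) + (a + 1) * (a + L).choose (c + 1) + (c + 1) * (a + 1).choose (c + 2)
      = (c + 1) * (a + L + 1).choose (c + 2) + (a + 1) * a.choose (c + 1) := by
  induction L with
  | zero => simp [add_comm]
  | succ L ih =>
    rw [sum_range_succ]
    have h1 : (a + L + 1) * (a + L).choose c = (a + L + 1).choose (c + 1) * (c + 1) :=
      Nat.add_one_mul_choose_eq (a + L) c
    have h2 : (a + L + 1).choose (c + 1) = (a + L).choose c + (a + L).choose (c + 1) :=
      Nat.choose_succ_succ (a + L) c
    have h3 : (a + L + 1 + 1).choose (c + 2) = (a + L + 1).choose (c + 1) + (a + L + 1).choose (c + 2) :=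
      Nat.choose_succ_succ (a + L + 1) (c + 1)
    have e1 : a + (L + 1) = a + L + 1 := by ring
    rw [e1, h3]
    zify at ih h1 h2 ⊢
    linear_combination ih + h1 + (↑a + 1 : ℤ) * h2

/-- Row identity (`× (c+2)`): `(c+2)·Σ_{j<n} j·C(a+j,c) + (a+1)·C(a+n,c+1) = (c+1)·n·C(a+n,c+1) + (a+1)·C(a,c+1)`. [folklore] -/
theorem row_identity (a c n : ℕ) :
    (c + 2) * (∑ j ∈ range n, j * (a + j).choose c) + (a + 1) * (a + n).choose (c + 1)
      = (c + 1) * n * (a + n).choose (c + 1) + (a + 1) * a.choose (c + 1) := by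
  have h := inner_identity a c n
  have h4 : (a + n + 1) * (a + n).choose (c + 1) = (a + n + 1).choose (c + 2) * (c + 2) :=
    Nat.add_one_mul_choose_eq (a + n) (c + 1)
  have h5 : (a + 1) * a.choose (c + 1) = (a + 1).choose (c + 2) * (c + 2) :=
    Nat.add_one_mul_choose_eq a (c + 1)
  zify at h h4 h5 ⊢
  linear_combination (↑c + 2 : ℤ) * h - (↑c + 1 : ℤ) * h4 + (↑c + 1 : ℤ) * h5

/-- `ltCount n c 1` as a `range` double sum with weight `i·j`. [folklore] -/
theorem ltCount_one_eq_range (n c : ℕ) :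
    ltCount n c 1 = ∑ i ∈ range n, ∑ j ∈ range n, i * j * (i * n + j).choose c := by
  unfold ltCount
  have h : ∀ i : ℕ, (∑ j : Fin n, i.choose 1 * (j : ℕ).choose 1 * (i * n + (j : ℕ)).choose c)
      = ∑ j ∈ range n, i * j * (i * n + j).choose c := by
    intro i
    rw [Fin.sum_univ_eq_sum_range (fun j => i.choose 1 * j.choose 1 * (i * n + j).choose c) n]
    simp only [Nat.choose_one_right]
  simp_rw [h]
  exact Fin.sum_univ_eq_sum_range (fun i => ∑ j ∈ range n, i * j * (i * n + j).choose c) n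

/-- The truncated double sum (`i < L`, `j < n`) satisfies, for `L = M+1`:
`(c+2)·Σ + M((M+1)n+1)·C((M+1)n,c+1) + n(c+2)·Σ_{i≤M} C(i·n,c+1) = M(c+2)n·C((M+1)n,c+1) + (c+3)n·Σ_{i≤M} i·C(i·n,c+1) + Σ_{i≤M} C(i·n,c+1)`
(Abel summation of `row_identity`, by induction on `M`). [folklore] -/
theorem truncated_identity (n c M : ℕ) :
    (c + 2) * (∑ i ∈ range (M + 1), ∑ j ∈ range n, i * j * (i * n + j).choose c)
      + M * ((M + 1) * n + 1) * ((M + 1) * n).choose (c + 1)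
      + n * (c + 2) * (∑ i ∈ range (M + 1), (i * n).choose (c + 1))
      = M * (c + 2) * n * ((M + 1) * n).choose (c + 1)
      + (c + 3) * n * (∑ i ∈ range (M + 1), i * (i * n).choose (c + 1))
      + (∑ i ∈ range (M + 1), (i * n).choose (c + 1)) := by
  induction M with
  | zero => simp
  | succ M ih =>
    rw [sum_range_succ _ (M + 1), sum_range_succ _ (M + 1), sum_range_succ _ (M + 1)]
    -- the new row `i = M+1`, base position `a = (M+1)·n`
    have hrow := row_identity ((M + 1) * n) c n
    have ea : (M + 1) * n + n = (M + 1 + 1) * n := by ring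
    rw [ea] at hrow
    have hS : (∑ j ∈ range n, (M + 1) * j * ((M + 1) * n + j).choose c)
        = (M + 1) * ∑ j ∈ range n, j * ((M + 1) * n + j).choose c := by
      rw [mul_sum]; refine sum_congr rfl fun j _ => by ring
    rw [hS]
    zify at ih hrow ⊢
    linear_combination ih + (↑M + 1 : ℤ) * hrow

/-- **The exact `k = 1` leading-term count** (all-`ℕ` form):
`(c+2)·LT(n,c,1) + (n-1)(n²+1)·C(n²,c+1) + n(c+2)·Σ_{i<n} C(i·n,c+1) = (n-1)(c+2)n·C(n²,c+1) + (c+3)n·Σ_{i<n} i·C(i·n,c+1) + Σ_{i<n} C(i·n,c+1)`.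
[folklore] -/
theorem ltCount_one_identity (n c : ℕ) :
    (c + 2) * ltCount n c 1 + (n - 1) * (n * n + 1) * (n * n).choose (c + 1)
      + n * (c + 2) * (∑ i ∈ range n, (i * n).choose (c + 1))
      = (n - 1) * (c + 2) * n * (n * n).choose (c + 1)
      + (c + 3) * n * (∑ i ∈ range n, i * (i * n).choose (c + 1))
      + (∑ i ∈ range n, (i * n).choose (c + 1)) := by
  rcases Nat.eq_zero_or_pos n with rfl | hn
  · simp [ltCount]
  · obtain ⟨M, rfl⟩ : ∃ M, n = M + 1 := ⟨n - 1, by omega⟩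
    rw [ltCount_one_eq_range, show M + 1 - 1 = M from rfl]
    exact truncated_identity (M + 1) c M

/-- The same identity over `ℤ`, solved for `(c+2)·LT(n,c,1)` (`n ≥ 1`):
`(c+2)·LT(n,c,1) = (n-1)((c+2)n - n² - 1)·C(n²,c+1) + Σ_{i<n} ((c+3)n·i - (c+2)n + 1)·C(i·n,c+1)`. [folklore] -/
theorem ltCount_one_int (n c : ℕ) (hn : 1 ≤ n) :
    ((c + 2) * ltCount n c 1 : ℤ)
      = ((n : ℤ) - 1) * ((c + 2) * n - n * n - 1) * ((n * n).choose (c + 1) : ℕ)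
        + ∑ i ∈ range n, ((c + 3) * (n : ℤ) * i - (c + 2) * n + 1) * ((i * n).choose (c + 1) : ℕ) := by
  have h := ltCount_one_identity n c
  obtain ⟨M, rfl⟩ : ∃ M, n = M + 1 := ⟨n - 1, by omega⟩
  rw [show M + 1 - 1 = M from rfl] at h
  zify at h
  have e : (∑ i ∈ range (M + 1), ((c + 3) * ((M + 1 : ℕ) : ℤ) * i - (c + 2) * ((M + 1 : ℕ) : ℤ) + 1)
        * (((i * (M + 1)).choose (c + 1) : ℕ) : ℤ))
      = (c + 3) * ((M + 1 : ℕ) : ℤ) * (∑ i ∈ range (M + 1), (i : ℤ) * (((i * (M + 1)).choose (c + 1) : ℕ) : ℤ))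
        - ((c + 2) * ((M + 1 : ℕ) : ℤ) - 1) * (∑ i ∈ range (M + 1), (((i * (M + 1)).choose (c + 1) : ℕ) : ℤ)) := by
    rw [mul_sum, mul_sum, ← sum_sub_distrib]
    refine sum_congr rfl fun i _ => by ring
  rw [e]
  push_cast at h ⊢
  linear_combination h

/-! ## Kernel mirrors (`decide +kernel`) -/

/-- Structurally recursive range sum (kernel-friendly stand-in for `∑ i ∈ range L`). [folklore] -/
def sumR (f : ℕ → ℕ) : ℕ → ℕ
  | 0 => 0
  | L + 1 => sumR f L + f L

/-- `sumR f L = Σ_{i<L} f i`. [folklore] -/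
theorem sumR_eq (f : ℕ → ℕ) (L : ℕ) : sumR f L = ∑ i ∈ range L, f i := by
  induction L with
  | zero => simp [sumR]
  | succ L ih => rw [sumR, ih, sum_range_succ]

/-- Kernel mirror of `LT(n,c,1)` via `ltCount_one_identity` (`2n+1` binomials instead of `n²`). [folklore] -/
def ltOneD (n c : ℕ) : ℕ :=
  ((n - 1) * (c + 2) * n * binomD (n * n) (c + 1) + (c + 3) * n * sumR (fun i => i * binomD (i * n) (c + 1)) n
      + sumR (fun i => binomD (i * n) (c + 1)) n
    - ((n - 1) * (n * n + 1) * binomD (n * n) (c + 1) + n * (c + 2) * sumR (fun i => binomD (i * n) (c + 1)) n))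
    / (c + 2)

/-- `ltOneD n c = ltCount n c 1`. [folklore] -/
theorem ltOneD_eq (n c : ℕ) : ltOneD n c = ltCount n c 1 := by
  have h := ltCount_one_identity n c
  unfold ltOneD
  simp only [sumR_eq, binomD_eq]
  rw [← h, show (c + 2) * ltCount n c 1 + (n - 1) * (n * n + 1) * (n * n).choose (c + 1)
      + n * (c + 2) * ∑ i ∈ range n, (i * n).choose (c + 1)
      - ((n - 1) * (n * n + 1) * (n * n).choose (c + 1) + n * (c + 2) * ∑ i ∈ range n, (i * n).choose (c + 1))
      = (c + 2) * ltCount n c 1 by omega]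
  exact Nat.mul_div_cancel_left _ (by omega)

/-- Brute-force kernel mirror of `LT(n,c,k)` (`n²` terms; for `k ≥ 2` cells). [folklore] -/
def ltCountD (n c k : ℕ) : ℕ :=
  sumR (fun i => sumR (fun j => binomD i k * binomD j k * binomD (i * n + j) c) n) n

/-- `ltCountD = ltCount`. [folklore] -/
theorem ltCountD_eq (n c k : ℕ) : ltCountD n c k = ltCount n c k := by
  unfold ltCountD ltCount
  simp only [sumR_eq, binomD_eq]
  have h : ∀ i : ℕ, (∑ j : Fin n, i.choose k * (j : ℕ).choose k * (i * n + (j : ℕ)).choose c)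
      = ∑ j ∈ range n, i.choose k * j.choose k * (i * n + j).choose c :=
    fun i => Fin.sum_univ_eq_sum_range (fun j => i.choose k * j.choose k * (i * n + j).choose c) n
  simp_rw [h]
  exact (Fin.sum_univ_eq_sum_range (fun i => ∑ j ∈ range n, i.choose k * j.choose k * (i * n + j).choose c) n).symm

/-- The primal `k = 1` cell test of the W1′ assemblies on the mirrors:
`min (S(m,1)·C(n²,c+1)) (S(m,2)·C(n²,c)) ≤ LT(n,c,1)`. [folklore] -/
def kOneCell (m n c : ℕ) : Bool :=
  decide (min (chooseSqSumD m 1 * binomD (n * n) (c + 1)) (chooseSqSumD m 2 * binomD (n * n) c) ≤ ltOneD n c)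

/-- Soundness of the cell test. [folklore] -/
theorem kOneCell_sound (m n c : ℕ) (h : kOneCell m n c = true) :
    min (chooseSqSum m 1 * (n * n).choose (c + 1)) (chooseSqSum m 2 * (n * n).choose c) ≤ ltCount n c 1 := by
  have h' := of_decide_eq_true h
  simpa only [chooseSqSumD_eq, binomD_eq, ltOneD_eq] using h'

/-- The primal cell test for general `k` on the brute-force mirror (`n²` terms; for the few `k ≥ 2` residual cells):
`min (S(m,k)·C(n²,c+1)) (S(m,k+1)·C(n²,c)) ≤ LT(n,c,k)`. [folklore] -/
def kCell (m n c k : ℕ) : Bool :=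
  decide (min (chooseSqSumD m k * binomD (n * n) (c + 1)) (chooseSqSumD m (k + 1) * binomD (n * n) c) ≤ ltCountD n c k)

/-- Soundness of the general cell test. [folklore] -/
theorem kCell_sound (m n c k : ℕ) (h : kCell m n c k = true) :
    min (chooseSqSum m k * (n * n).choose (c + 1)) (chooseSqSum m (k + 1) * (n * n).choose c) ≤ ltCount n c k := by
  have h' := of_decide_eq_true h
  simpa only [chooseSqSumD_eq, binomD_eq, ltCountD_eq] using h'

/-! ## The residual cells at `n = ⌈3m/2⌉`, `5 ≤ m ≤ 12` (kernel-decided)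

For `5 ≤ m ≤ 12` the cells not certified by `max(CHEB,TK)` are (exact numerics, THEORY-2 gen 26/27): `k = 1` with
`c ∈ [9,63], [8,80], [10,119], [8,143], [10,28], [8,224], [10,19], [9,323]` for `m = 5, …, 12`, and `k = 2`, `c ∈ [21,80]`
at `m = 6` (995 cells).  The box `k = 1`, `8 ≤ c < n²` (1 388 cells) and the `m = 6`, `k = 2` window cover them. -/

/-- Residual box, `5 ≤ m ≤ 12`, `k = 1`, `8 ≤ c < n²`, `n = ⌈3m/2⌉`: the cell test passes (kernel). [folklore] -/
theorem window_5_12D : ∀ m, 5 ≤ m → m ≤ 12 →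
    ∀ c, 8 ≤ c → c < ((3 * m + 1) / 2) * ((3 * m + 1) / 2) → kOneCell m ((3 * m + 1) / 2) c = true := by
  decide +kernel

/-- Residual window `m = 6`, `n = 9`, `k = 2`, `21 ≤ c ≤ 80`: the cell test passes (kernel, brute-force mirror). [folklore] -/
theorem window_6_k2D : ∀ c, 21 ≤ c → c ≤ 80 → kCell 6 9 c 2 = true := by
  decide +kernel

/-- The residual cells for `5 ≤ m ≤ 12` at `n = ⌈3m/2⌉`, as primal cell inequalities: `k = 1`, `8 ≤ c`, `c+1 ≤ n²`. [folklore] -/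
theorem window_5_12 (m c : ℕ) (hm : 5 ≤ m) (hm' : m ≤ 12) (hc : 8 ≤ c)
    (hc' : c + 1 ≤ ((3 * m + 1) / 2) * ((3 * m + 1) / 2)) :
    min (chooseSqSum m 1 * (((3 * m + 1) / 2) * ((3 * m + 1) / 2)).choose (c + 1))
        (chooseSqSum m 2 * (((3 * m + 1) / 2) * ((3 * m + 1) / 2)).choose c)
      ≤ ltCount ((3 * m + 1) / 2) c 1 :=
  kOneCell_sound _ _ _ (window_5_12D m hm hm' c hc (by omega))

/-- The residual window `m = 6`, `k = 2` (`n = 9`, `21 ≤ c ≤ 80`), as primal cell inequalities. [folklore] -/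
theorem window_6_k2 (c : ℕ) (hc : 21 ≤ c) (hc' : c ≤ 80) :
    min (chooseSqSum 6 2 * (9 * 9).choose (c + 1)) (chooseSqSum 6 3 * (9 * 9).choose c) ≤ ltCount 9 c 2 :=
  kCell_sound _ _ _ _ (window_6_k2D c hc hc')

/-! ## The residual `k = 1` windows at `n = ⌈3m/2⌉`, `13 ≤ m ≤ 63` (kernel-decided)

At `n = ⌈3m/2⌉` (`= (3m+1)/2` in `ℕ`) the closed forms `max(CHEB,TK)` of `Max/KYSharperLowK` certify every primal cell
except a `k = 1` window `9 ≤ c ≤ c₁(m)` (exact numerics, FINDINGS-W1B-SCOPE §1 / THEORY-2 gen 27 `calc34`: `c₁ = 15, 58, 13,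
32, 12, 24, 11, 19, 10, 17, 10, 15` for `m = 13 … 24`, `c₁ ≤ 14` for `25 ≤ m ≤ 63`; 185 cells).  The three boxes below cover
these windows with margin (562 cells); every cell in a box holds because the exact `LT` dominates both the window cells and
the closed forms. -/

/-- Box bound for the residual windows: `58` (`m ≤ 16`), `24` (`17 ≤ m ≤ 24`), `14` (`m ≥ 25`). [folklore] -/
def cBox (m : ℕ) : ℕ := if m ≤ 16 then 58 else if m ≤ 24 then 24 else 14

/-- Residual box, `13 ≤ m ≤ 16`, `9 ≤ c ≤ 58`, `n = ⌈3m/2⌉`: the cell test passes (kernel). [folklore] -/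
theorem window_13_16D : ∀ m, 13 ≤ m → m ≤ 16 → ∀ c, 9 ≤ c → c ≤ 58 → kOneCell m ((3 * m + 1) / 2) c = true := by
  decide +kernel

/-- Residual box, `17 ≤ m ≤ 24`, `9 ≤ c ≤ 24`, `n = ⌈3m/2⌉`: the cell test passes (kernel). [folklore] -/
theorem window_17_24D : ∀ m, 17 ≤ m → m ≤ 24 → ∀ c, 9 ≤ c → c ≤ 24 → kOneCell m ((3 * m + 1) / 2) c = true := by
  decide +kernel

/-- Residual box, `25 ≤ m ≤ 63`, `9 ≤ c ≤ 14`, `n = ⌈3m/2⌉`: the cell test passes (kernel). [folklore] -/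
theorem window_25_63D : ∀ m, 25 ≤ m → m ≤ 63 → ∀ c, 9 ≤ c → c ≤ 14 → kOneCell m ((3 * m + 1) / 2) c = true := by
  decide +kernel

/-- The residual `k = 1` windows for `13 ≤ m ≤ 63` at `n = ⌈3m/2⌉`, as primal cell inequalities
`min (S(m,1)·C(n²,c+1)) (S(m,2)·C(n²,c)) ≤ LT(n,c,1)` for `9 ≤ c ≤ cBox m`. [folklore] -/
theorem window_13_63 (m c : ℕ) (hm : 13 ≤ m) (hm' : m ≤ 63) (hc : 9 ≤ c) (hc' : c ≤ cBox m) :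
    min (chooseSqSum m 1 * (((3 * m + 1) / 2) * ((3 * m + 1) / 2)).choose (c + 1))
        (chooseSqSum m 2 * (((3 * m + 1) / 2) * ((3 * m + 1) / 2)).choose c)
      ≤ ltCount ((3 * m + 1) / 2) c 1 := by
  apply kOneCell_sound
  unfold cBox at hc'
  by_cases h16 : m ≤ 16
  · rw [if_pos h16] at hc'; exact window_13_16D m hm h16 c hc hc'
  · rw [if_neg h16] at hc'
    by_cases h24 : m ≤ 24
    · rw [if_pos h24] at hc'; exact window_17_24D m (by omega) h24 c hc hc'
    · rw [if_neg h24] at hc'; exact window_25_63D m (by omega) hm' c hc hc'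

/-- Statement node: the exact `k = 1` count (all-`ℕ` and `ℤ` forms), the mirrors, and the kernel-decided residual cells of
the `n = ⌈3m/2⌉` programme (`5 ≤ m ≤ 63`; 1 180 residual cells, covered by 2 010 decided cells). [folklore] -/
def KYKOneExactFacts : Prop :=
  (∀ n c : ℕ, (c + 2) * ltCount n c 1 + (n - 1) * (n * n + 1) * (n * n).choose (c + 1)
      + n * (c + 2) * (∑ i ∈ range n, (i * n).choose (c + 1))
      = (n - 1) * (c + 2) * n * (n * n).choose (c + 1)
      + (c + 3) * n * (∑ i ∈ range n, i * (i * n).choose (c + 1)) + (∑ i ∈ range n, (i * n).choose (c + 1)))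
  ∧ (∀ n c : ℕ, 1 ≤ n → ((c + 2) * ltCount n c 1 : ℤ)
      = ((n : ℤ) - 1) * ((c + 2) * n - n * n - 1) * ((n * n).choose (c + 1) : ℕ)
        + ∑ i ∈ range n, ((c + 3) * (n : ℤ) * i - (c + 2) * n + 1) * ((i * n).choose (c + 1) : ℕ))
  ∧ (∀ n c : ℕ, ltOneD n c = ltCount n c 1)
  ∧ (∀ n c k : ℕ, ltCountD n c k = ltCount n c k)
  ∧ (∀ m c : ℕ, 5 ≤ m → m ≤ 12 → 8 ≤ c → c + 1 ≤ ((3 * m + 1) / 2) * ((3 * m + 1) / 2) →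
      min (chooseSqSum m 1 * (((3 * m + 1) / 2) * ((3 * m + 1) / 2)).choose (c + 1))
          (chooseSqSum m 2 * (((3 * m + 1) / 2) * ((3 * m + 1) / 2)).choose c)
        ≤ ltCount ((3 * m + 1) / 2) c 1)
  ∧ (∀ c : ℕ, 21 ≤ c → c ≤ 80 →
      min (chooseSqSum 6 2 * (9 * 9).choose (c + 1)) (chooseSqSum 6 3 * (9 * 9).choose c) ≤ ltCount 9 c 2)
  ∧ (∀ m c : ℕ, 13 ≤ m → m ≤ 63 → 9 ≤ c → c ≤ cBox m →
      min (chooseSqSum m 1 * (((3 * m + 1) / 2) * ((3 * m + 1) / 2)).choose (c + 1))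
          (chooseSqSum m 2 * (((3 * m + 1) / 2) * ((3 * m + 1) / 2)).choose c)
        ≤ ltCount ((3 * m + 1) / 2) c 1)

/-- `KYKOneExactFacts` holds. [folklore] -/
theorem kyKOneExactFacts_holds : KYKOneExactFacts :=
  ⟨ltCount_one_identity, ltCount_one_int, ltOneD_eq, ltCountD_eq,
    fun m c hm hm' hc hc' => window_5_12 m c hm hm' hc hc',
    fun c hc hc' => window_6_k2 c hc hc',
    fun m c hm hm' hc hc' => window_13_63 m c hm hm' hc hc'⟩

end KYKOneExact
end Summit.PneNP.GCT
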